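import Summits.CriticalPhenomena.SAWScalingLimit.Theorems.SAWDevelopingMapObservableToSLECanonicalTransferDictionary
import Summits.CriticalPhenomena.SAWScalingLimit.Theorems.SAWDevelopingMapObservableToSLECanonicalTransferPendantSandwich
import HarnessLib

/-!
# Crux `SAWDevelopingMap.ObservableToSLE` (stmt-CriticalPhenomena-10472), line
`floor-ratio-restriction-bootstrap`: the fixed-scale dictionary for `stub_canonicalTransfer`, pendant case

Landing target:
`Summits/CriticalPhenomena/SAWScalingLimit/Theorems/SAWDevelopingMapObservableToSLECanonicalTransferPendant.lean`
(`--supports stmt-CriticalPhenomena-10472`).  Sequel of `…CanonicalTransferDictionary.lean` and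
`…CanonicalTransferPendantSandwich.lean`.

In the PENDANT case of the canonical domain of a floor domain (`frac(2h/(√3 δ)) ∈ [1/3, 2/3)`,
`…CanonicalTransferFloor.lean`) the canonical endpoints `a`, `b` of `stub_canonicalTransfer` hang
below the first full row by forced vertical end-steps `a ∼ a'`, `b' ∼ b`.  When the domain
WITHOUT its pendant vertices is carried by a finite vertex set `Λ` with no bad honeycomb edge and
`Λ' = Λ ∩ Ω'_δ` has no bad edge either, the `hexSAWLaw`-probability of the event of
`stub_canonicalTransfer` is EXACTLY the ratio `Z_{Λ'}(s_a,s_b)/Z_Λ(s_a,s_b)` of Duminil-Copin–Smirnov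
partition functions between the vertical mid-edges `s_a = {a', a}`, `s_b = {b', b}` (the factor
`x_c²` of the two forced end-steps cancels):

* `hexSAWLaw_meshEvent_toReal_eq_div_pendant` = registered sub-goal
  `stub_canonicalTransfer_pendant`.
-/

noncomputable section

open scoped BigOperators Classical ENNReal
open MeasureTheory
open Literature.Probability.LatticeModels (HexVertex hexGraph hexCenter)
open Literature.Probability.RandomPlanarGeometry
open Literature.Probability.RandomPlanarGeometry.SAW

namespace Summit.CriticalPhenomena.SAWScalingLimit.Theorems.ObservableToSLE.FloorRatio

/-! ### The fixed-scale dictionary with pendant endpoints -/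

section FixedScalePendant

variable {Ω Ω' : Set ℂ} {δ : ℝ} {Λ Λ' : Finset HexVertex} {a b a' b' : HexVertex}

/-- **The fixed-scale dictionary, pendant case** (named-hypotheses form of the registered
sub-goal `stub_canonicalTransfer_pendant` below).  In the PENDANT case of the canonical domain of
a floor domain (`frac(2h/(√3 δ)) ∈ [1/3, 2/3)`: the canonical endpoints `a`, `b` are one-sided
lowest-row vertices of `Ω_δ` hanging below `a'`, `b'`), let `Λ` (the domain WITHOUT its pendant
vertices) satisfy: every honeycomb edge inside `Λ` is an edge of `Ω_δ`, every vertex outside `Λ`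
has at most one `Ω_δ`-neighbour, `a ≠ b` are outside `Λ` with unique `Ω_δ`-neighbours
`a', b' ∈ Λ`, `a' ≠ b`; let `Λ' = Λ ∩ Ω'_δ` have no bad edge and let the two end-steps be
`Ω'`-mesh edges.  Then the `hexSAWLaw Ω δ a b`-probability of the event of `stub_canonicalTransfer`
is EXACTLY `Z_{Λ'}(s_a, s_b)/Z_Λ(s_a, s_b)` for the vertical boundary mid-edges `s_a = {a', a}`,
`s_b = {b', b}` (the factor `x_c²` of the two forced end-steps cancels).
[cite: DuminilCopinSmirnov2012, §4 (before Conjecture 1)] -/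
theorem hexSAWLaw_meshEvent_toReal_eq_div_pendant
    (hΛ : ∀ v ∈ Λ, ∀ w ∈ Λ, hexGraph.Adj v w → (hexDomainGraph Ω δ).Adj v w)
    (hout : ∀ v ∉ (↑Λ : Set HexVertex), ∀ y y', (hexDomainGraph Ω δ).Adj v y →
      (hexDomainGraph Ω δ).Adj v y' → y = y')
    (hab : a ≠ b) (haΛ : a ∉ Λ) (hbΛ : b ∉ Λ) (ha'Λ : a' ∈ Λ) (hb'Λ : b' ∈ Λ) (ha'b : a' ≠ b)
    (ha : ∀ w, (hexDomainGraph Ω δ).Adj a w ↔ w = a')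
    (hb : ∀ w, (hexDomainGraph Ω δ).Adj b w ↔ w = b')
    (hΛ' : ∀ v, v ∈ Λ' ↔ v ∈ Λ ∧ v ∈ embMeshVertices hexCenter Ω' δ)
    (hΛ'e : ∀ v ∈ Λ', ∀ w ∈ Λ', hexGraph.Adj v w →
      (embMeshGraph hexGraph hexCenter Ω' δ).Adj v w)
    (haΩ' : a ∈ embMeshVertices hexCenter Ω' δ) (hbΩ' : b ∈ embMeshVertices hexCenter Ω' δ)
    (haa' : (embMeshGraph hexGraph hexCenter Ω' δ).Adj a a')
    (hbb' : (embMeshGraph hexGraph hexCenter Ω' δ).Adj b b') :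
    ((hexSAWLaw Ω δ a b)
      {γ | (∀ v ∈ γ.walk.support, v ∈ embMeshVertices hexCenter Ω' δ) ∧
        ∀ e ∈ γ.walk.darts, (embMeshGraph hexGraph hexCenter Ω' δ).Adj e.fst e.snd}).toReal =
      (∑ γ : HexMidEdgeSAW Λ' s(a', a) s(b', b), hexCriticalFugacity ^ γ.length) /
        ∑ γ : HexMidEdgeSAW Λ s(a', a) s(b', b), hexCriticalFugacity ^ γ.length := by
  have hne : s(a', a) ≠ s(b', b) := by
    intro h
    rcases Sym2.eq_iff.1 h with ⟨-, h2⟩ | ⟨h1, -⟩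
    · exact hab h2
    · exact ha'b h1
  have hadj : hexGraph.Adj a' a :=
    (embDomainGraph_le hexGraph hexCenter Ω δ ((ha a').2 rfl)).symm
  -- `e₀`: forget/remember the structure
  let e₀ : HexDomainSAW Ω δ a b ≃ {p : (hexDomainGraph Ω δ).Walk a b // p.IsPath} :=
    ⟨fun γ => ⟨γ.walk, γ.isPath⟩, fun p => ⟨p.1, p.2⟩, fun _ => rfl, fun _ => rfl⟩
  -- `e₁`: strip the two forced end-steps
  obtain ⟨e₁, he₁⟩ := exists_equiv_isPath_pendant (G := hexDomainGraph Ω δ) hab ha hb ha'b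
  -- `e₂`: inner walks avoiding `a`, `b` = inner walks inside `Λ`
  have key₂ : ∀ q : (hexDomainGraph Ω δ).Walk a' b', q.IsPath →
      (a ∉ q.support ∧ b ∉ q.support ↔ ∀ w ∈ q.support, w ∈ (↑Λ : Set HexVertex)) := by
    intro q hq
    constructor
    · rintro ⟨hqa, hqb⟩ w hw
      by_cases hwa' : w = a'
      · rw [hwa']; exact ha'Λ
      by_cases hwb' : w = b'
      · rw [hwb']; exact hb'Λ
      exact mem_of_mem_support_isPath hout hq hw hwa' hwb'
    · intro h
      exact ⟨fun hm => haΛ (h a hm), fun hm => hbΛ (h b hm)⟩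
  let e₂ : {q : (hexDomainGraph Ω δ).Walk a' b' // q.IsPath ∧ a ∉ q.support ∧ b ∉ q.support} ≃
      {q : (hexDomainGraph Ω δ).Walk a' b' // q.IsPath ∧ ∀ w ∈ q.support,
        w ∈ (↑Λ : Set HexVertex)} :=
    ⟨fun q => ⟨q.1, q.2.1, (key₂ q.1 q.2.1).1 q.2.2⟩,
      fun q => ⟨q.1, q.2.1, (key₂ q.1 q.2.1).2 q.2.2⟩, fun _ => rfl, fun _ => rfl⟩
  -- `e₃`, `e₄`: to honeycomb paths inside `Λ`, then to mid-edge walks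
  obtain ⟨e₃, he₃⟩ := exists_equiv_isPath_of_le (embDomainGraph_le hexGraph hexCenter Ω δ)
    (Λ := (↑Λ : Set HexVertex)) (fun v hv w hw h => hΛ v hv w hw h) a' b'
  obtain ⟨e₄, he₄⟩ := exists_equiv_isPath_hexMidEdgeSAW (vb := b') ha'Λ haΛ hbΛ hadj hne
  set E : HexDomainSAW Ω δ a b ≃ HexMidEdgeSAW Λ s(a', a) s(b', b) :=
    (((e₀.trans e₁).trans e₂).trans e₃).trans e₄ with hEdef
  have hE : ∀ γ, γ.walk.support = a :: ((E γ).verts ++ [b]) := fun γ => by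
    rw [hEdef, Equiv.trans_apply, Equiv.trans_apply, Equiv.trans_apply, Equiv.trans_apply, he₄,
      he₃]
    exact he₁ (e₀ γ)
  have hElen : ∀ γ, γ.vertexCount = (E γ).length + 2 := fun γ => by
    have h := congrArg List.length (hE γ)
    rw [SimpleGraph.Walk.length_support, List.length_cons, List.length_append,
      List.length_singleton] at h
    rw [HexMidEdgeSAW.length, ← h]
    rfl
  have hsupp : ∀ (γ : HexDomainSAW Ω δ a b), ∀ v ∈ γ.walk.support,
      v = a ∨ v = b ∨ v ∈ (E γ).verts := fun γ v hv => by
    rw [hE γ, List.mem_cons, List.mem_append, List.mem_singleton] at hv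
    tauto
  -- the event is `verts ⊆ Λ'`
  have hevent : ∀ γ : HexDomainSAW Ω δ a b,
      ((∀ v ∈ γ.walk.support, v ∈ embMeshVertices hexCenter Ω' δ) ∧
        ∀ e ∈ γ.walk.darts, (embMeshGraph hexGraph hexCenter Ω' δ).Adj e.fst e.snd) ↔
      ∀ v ∈ (E γ).verts, v ∈ Λ' := by
    intro γ
    constructor
    · rintro ⟨hv, -⟩ v hvv
      have hvs : v ∈ γ.walk.support := by
        rw [hE γ, List.mem_cons, List.mem_append]
        exact Or.inr (Or.inl hvv)
      exact (hΛ' v).2 ⟨(E γ).subset v hvv, hv v hvs⟩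
    · intro h
      refine ⟨fun v hv => ?_, fun e he => ?_⟩
      · rcases hsupp γ v hv with rfl | rfl | hv'
        exacts [haΩ', hbΩ', ((hΛ' v).1 (h v hv')).2]
      · have hd : (hexDomainGraph Ω δ).Adj e.fst e.snd := e.adj
        have h1 := hsupp γ _ (γ.walk.dart_fst_mem_support_of_mem_darts he)
        have h2 := hsupp γ _ (γ.walk.dart_snd_mem_support_of_mem_darts he)
        by_cases hfa : e.fst = a
        · have hs : e.snd = a' := (ha _).1 (by rw [← hfa]; exact hd)
          rw [hfa, hs]; exact haa'
        by_cases hsa : e.snd = a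
        · have hs : e.fst = a' := (ha _).1 (by rw [← hsa]; exact hd.symm)
          rw [hsa, hs]; exact haa'.symm
        by_cases hfb : e.fst = b
        · have hs : e.snd = b' := (hb _).1 (by rw [← hfb]; exact hd)
          rw [hfb, hs]; exact hbb'
        by_cases hsb : e.snd = b
        · have hs : e.fst = b' := (hb _).1 (by rw [← hsb]; exact hd.symm)
          rw [hsb, hs]; exact hbb'.symm
        have h1' : e.fst ∈ (E γ).verts := by
          rcases h1 with h1 | h1 | h1
          exacts [absurd h1 hfa, absurd h1 hfb, h1]
        have h2' : e.snd ∈ (E γ).verts := by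
          rcases h2 with h2 | h2 | h2
          exacts [absurd h2 hsa, absurd h2 hsb, h2]
        exact hΛ'e _ (h _ h1') _ (h _ h2') (embDomainGraph_le hexGraph hexCenter Ω δ hd)
  haveI : Fintype (HexDomainSAW Ω δ a b) := Fintype.ofEquiv _ E.symm
  have hsub : Λ' ⊆ Λ := fun v hv => ((hΛ' v).1 hv).1
  have hx : (hexCriticalFugacity ^ 2 : ℝ) ≠ 0 := pow_ne_zero _ hexCriticalFugacity_pos_lt_one.1.ne'
  rw [hexSAWLaw_apply_toReal_eq_div, Finset.sum_filter,
    ← sum_ite_subset_pow_length_eq hsub hne, ← E.sum_comp, ← E.sum_comp]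
  conv_rhs => rw [← mul_div_mul_left _ _ hx, Finset.mul_sum, Finset.mul_sum]
  congr 1
  · refine Finset.sum_congr rfl fun γ _ => ?_
    rw [hElen, pow_add, mul_comm]
    by_cases h : ∀ v ∈ (E γ).verts, v ∈ Λ'
    · rw [if_pos h, if_pos]
      exact (hevent γ).2 h
    · rw [if_neg h, if_neg, mul_zero]
      exact fun h' => h ((hevent γ).1 h')
  · exact Finset.sum_congr rfl fun γ _ => by rw [hElen, pow_add, mul_comm]

/-- **Registered sub-goal `stub_canonicalTransfer_pendant`** (crux item stmt-CriticalPhenomena-10472,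
line `floor-ratio-restriction-bootstrap`, stub `stub_canonicalTransfer`): the fixed-scale
dictionary with pendant canonical endpoints, in registry form (see
`hexSAWLaw_meshEvent_toReal_eq_div_pendant`). [cite: DuminilCopinSmirnov2012, §4 (before Conjecture 1)] -/
theorem stub_canonicalTransfer_pendant :
    ∀ (Ω Ω' : Set ℂ) (δ : ℝ) (Λ Λ' : Finset HexVertex) (a b a' b' : HexVertex),
    (∀ v ∈ Λ, ∀ w ∈ Λ, hexGraph.Adj v w → (hexDomainGraph Ω δ).Adj v w) →
    (∀ v ∉ (↑Λ : Set HexVertex), ∀ y y' : HexVertex, (hexDomainGraph Ω δ).Adj v y →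
      (hexDomainGraph Ω δ).Adj v y' → y = y') →
    a ≠ b → a ∉ Λ → b ∉ Λ → a' ∈ Λ → b' ∈ Λ → a' ≠ b →
    (∀ w : HexVertex, (hexDomainGraph Ω δ).Adj a w ↔ w = a') →
    (∀ w : HexVertex, (hexDomainGraph Ω δ).Adj b w ↔ w = b') →
    (∀ v : HexVertex, v ∈ Λ' ↔ v ∈ Λ ∧ v ∈ embMeshVertices hexCenter Ω' δ) →
    (∀ v ∈ Λ', ∀ w ∈ Λ', hexGraph.Adj v w → (embMeshGraph hexGraph hexCenter Ω' δ).Adj v w) →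
    a ∈ embMeshVertices hexCenter Ω' δ → b ∈ embMeshVertices hexCenter Ω' δ →
    (embMeshGraph hexGraph hexCenter Ω' δ).Adj a a' →
    (embMeshGraph hexGraph hexCenter Ω' δ).Adj b b' →
    ((hexSAWLaw Ω δ a b)
      {γ | (∀ v ∈ γ.walk.support, v ∈ embMeshVertices hexCenter Ω' δ) ∧
        ∀ e ∈ γ.walk.darts, (embMeshGraph hexGraph hexCenter Ω' δ).Adj e.fst e.snd}).toReal =
      (∑ γ : HexMidEdgeSAW Λ' s(a', a) s(b', b), hexCriticalFugacity ^ γ.length) /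
        ∑ γ : HexMidEdgeSAW Λ s(a', a) s(b', b), hexCriticalFugacity ^ γ.length :=
  fun _ _ _ _ _ _ _ _ _ hΛ hout hab haΛ hbΛ ha'Λ hb'Λ ha'b ha hb hΛ' hΛ'e haΩ' hbΩ' haa' hbb' =>
    hexSAWLaw_meshEvent_toReal_eq_div_pendant hΛ hout hab haΛ hbΛ ha'Λ hb'Λ ha'b ha hb hΛ' hΛ'e
      haΩ' hbΩ' haa' hbb'

end FixedScalePendant

end Summit.CriticalPhenomena.SAWScalingLimit.Theorems.ObservableToSLE.FloorRatio

end
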